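/-
Copyright (c) 2026. All rights reserved.
Released under Apache 2.0 license as described in the file LICENSE.
Authors: abc-iut cell, seat abc-iut-w5-d226 (gen 2; sub-DAG `AbsTopIII:Prop4.2` rows P42.i/L11 (sB
clause) and P42.i/L12 (Rmk 4.2.1) of plan/L4/SUBDAG-AbsTopIII-Prop42.md, at the MODEL).
-/
import Literature.AnabelianGeometry.AbsoluteAnabelian.ArchimedeanHolMonoidPairsLogFrobenius
import Mathlib.CategoryTheory.Core
import Mathlib.CategoryTheory.ObjectProperty.Equivalence
import HarnessLib

/-!
# [AbsTopIII] Prop 4.2 (i), `sB` clause, and Remark 4.2.1 at the model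

S. Mochizuki, *Topics in absolute anabelian geometry III*, Prop 4.2 (i) p. 105 and Remark 4.2.1 p. 106 of
the author's kurims manuscript (lit key `paper:url-5493eb38cbb7`, read on the page; bib key
`MochizukiAbsTopIII2015`).  PROOF-ONLY companion (no new notion) over abc-iut-L4-t10's model
(`AutHolFieldFunctor`, `𝒞^hol_TF = HolTFPair 𝔄`) and abc-iut-w5-d226's `𝒞^hol_T = HolMonoidPair 𝔄 T`
(`T ∈ {TM, TLG, TCG}`).

* **Prop 4.2 (i), `sB` clause**: "the categories … `𝒞^{hol-sB}_T = 𝒞̲^{hol-sB}_T` are id-rigid" — the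
  full subcategories "determined by the objects of strictly Belyi type" (Def 4.1 (iii)).  The interface
  `EA` carries no strictly-Belyi predicate, so the clause is proved for EVERY isomorphism-closed object
  property `Q` of `EA`: if the full subcategory `EA_Q` is id-rigid, so is the full subcategory of
  `𝒞^hol_T` on the pairs whose structure-orbispace satisfies `Q` (`HolTFPair.isIdRigid_fullSubcategory`,
  `HolMonoidPair.isIdRigid_fullSubcategory`; via Mathlib's `Equivalence.congrFullSubcategory` applied
  to `𝒞^hol_T ≌ EA`).
* **Remark 4.2.1**: "unlike the case with Proposition 3.2, (iv), the id-rigidity portion of Proposition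
  4.2, (i), is [as is easily verified] false for the '`𝒞̲̲`' [structure-isomorphisms] and '`𝒞̲̲̲`'
  [isomorphisms] versions of `𝒞^hol_T`, `𝒞^{hol-sB}_T`."  At the model a structure-isomorphism (a morphism
  whose `φ_𝕏` is an isomorphism) IS an isomorphism (`HolTFPair.isIso_of_isIso_base`,
  `HolMonoidPair.isIso_of_isIso_base`), so both versions are the groupoid `Core 𝒞^hol_T`; and the
  mechanism of the failure is made explicit and kernel-checked: a groupoid having an object with a
  NONTRIVIAL CENTRAL automorphism is not id-rigid (`not_isIdRigid_of_central`, the natural automorphism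
  of `𝟭` being conjugation-transport of that element to the isomorphism class and the identity
  elsewhere), whence `Core EA`, `Core 𝒞^hol_TF`, `Core 𝒞^hol_T` are not id-rigid as soon as some object
  `𝕏` of `EA` has an automorphism `≠ id` commuting with all of `Aut(𝕏)` (`AutHolFieldFunctor.not_isIdRigid_core_EA`,
  `HolTFPair.not_isIdRigid_core`, `HolMonoidPair.not_isIdRigid_core`) — in print: e.g. an elliptically
  admissible orbicurve dominated by a once-punctured elliptic curve, whose automorphism `[−1]` is
  central.  The existence of such an object of the GEOMETRIC `EA` is not asserted here (the interface
  `𝔄` is abstract); contrast: by Prop 4.2 (i) the versions with ALL finite étale morphisms are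
  id-rigid as soon as `EA` is.

Refereed pre-IUT anabelian geometry; nothing here bears on [IUTchIII] Cor. 3.12 or takes a side.
-/

set_option autoImplicit false

namespace Literature.AnabelianGeometry.AbsoluteAnabelian

open _root_.CategoryTheory

universe v u w

/-! ### A groupoid with a nontrivial central automorphism is not id-rigid -/

section Groupoid

variable {G : Type u} [Groupoid.{v} G]

/-- In a groupoid, a nontrivial automorphism `z` of an object `X` that commutes with every
automorphism of `X` yields a nontrivial automorphism of the identity functor (transport `z` along
chosen isomorphisms to the isomorphism class of `X`, identity elsewhere); so the groupoid is NOT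
id-rigid.  (The mechanism behind Remark 4.2.1.) [cite: MochizukiAbsTopIII2015, Remark 4.2.1 p.106] -/
theorem not_isIdRigid_of_central (X : G) (z : X ⟶ X) (hz : z ≠ 𝟙 X)
    (hc : ∀ g : X ⟶ X, g ≫ z = z ≫ g) : ¬ IsIdRigid G := by
  classical
  intro hrig
  -- the component at `Y`: conjugate `z` by a chosen `Y ⟶ X` if there is one, else the identity
  let c : ∀ Y : G, Y ⟶ Y := fun Y =>
    if h : Nonempty (Y ⟶ X) then h.some ≫ z ≫ Groupoid.inv h.some else 𝟙 Y
  have hcX : ∀ (Y : G) (e : Y ⟶ X), c Y = e ≫ z ≫ Groupoid.inv e := by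
    intro Y e
    have h : Nonempty (Y ⟶ X) := ⟨e⟩
    simp only [c, dif_pos h]
    -- `h.some` and `e` differ by an automorphism of `X`, which commutes with `z`
    have key : Groupoid.inv h.some ≫ e ≫ z = z ≫ Groupoid.inv h.some ≫ e := by
      simpa only [Category.assoc] using hc (Groupoid.inv h.some ≫ e)
    calc h.some ≫ z ≫ Groupoid.inv h.some
        = h.some ≫ (z ≫ Groupoid.inv h.some ≫ e) ≫ Groupoid.inv e := by simp
      _ = h.some ≫ (Groupoid.inv h.some ≫ e ≫ z) ≫ Groupoid.inv e := by rw [key]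
      _ = e ≫ z ≫ Groupoid.inv e := by simp
  have hc0 : ∀ Y : G, ¬ Nonempty (Y ⟶ X) → c Y = 𝟙 Y := fun Y h => by
    simp only [c, dif_neg h]
  let α : 𝟭 G ≅ 𝟭 G :=
    NatIso.ofComponents (fun Y => Groupoid.isoEquivHom _ _ |>.symm (c Y)) (by
      intro Y Y' f
      change f ≫ c Y' = c Y ≫ f
      by_cases h : Nonempty (Y ⟶ X)
      · obtain ⟨e⟩ := h
        rw [hcX Y e, hcX Y' (Groupoid.inv f ≫ e)]
        simp
      · have h' : ¬ Nonempty (Y' ⟶ X) := fun ⟨e'⟩ => h ⟨f ≫ e'⟩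
        rw [hc0 Y h, hc0 Y' h', Category.id_comp, Category.comp_id])
  have hα : α.hom.app X = z := by
    change c X = z
    rw [hcX X (𝟙 X)]
    simp
  have := hrig α
  apply hz
  rw [← hα, this]
  rfl

end Groupoid

/-- **Remark 4.2.1, abstract form for the core of a category**: if some object `X` of `C` has an
automorphism `z ≠ id` commuting with every automorphism of `X`, then the groupoid `Core C` of
isomorphisms of `C` is not id-rigid. [cite: MochizukiAbsTopIII2015, Remark 4.2.1 p.106] -/
theorem not_isIdRigid_core_of_central {C : Type u} [Category.{v} C] (X : C) (z : X ≅ X)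
    (hz : z ≠ Iso.refl X) (hc : ∀ g : X ≅ X, g ≪≫ z = z ≪≫ g) : ¬ IsIdRigid (Core C) := by
  refine not_isIdRigid_of_central (G := Core C) (Core.mk X) (CoreHom.mk z) ?_ ?_
  · intro h
    exact hz (by simpa using congrArg CoreHom.iso h)
  · intro g
    apply CoreHom.ext
    simpa using hc g.iso

/-! ### Remark 4.2.1 at the model -/

namespace AutHolFieldFunctor

variable (𝔄 : AutHolFieldFunctor.{u})

/-- **Rmk 4.2.1 for `E̲A̲`**: the subcategory of `EA` "determined by the isomorphisms" (`Core EA`) is not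
id-rigid as soon as some object has a nontrivial central automorphism (e.g. `[−1]` on an orbicurve
dominated by a once-punctured elliptic curve — existence in the geometric `EA` not asserted here).
[cite: MochizukiAbsTopIII2015, Remark 4.2.1 p.106] -/
theorem not_isIdRigid_core_EA (X : 𝔄.EA) (z : X ≅ X) (hz : z ≠ Iso.refl X)
    (hc : ∀ g : X ≅ X, g ≪≫ z = z ≪≫ g) : ¬ IsIdRigid (Core 𝔄.EA) :=
  not_isIdRigid_core_of_central X z hz hc

end AutHolFieldFunctor

namespace HolTFPair

variable {𝔄 : AutHolFieldFunctor.{u}}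

/-- A morphism of `TF`-pairs whose structure part `φ_𝕏` is an isomorphism (a "structure-isomorphism",
Def 4.1 (ii)) is an isomorphism: at the model `𝒞̲̲^hol_TF = 𝒞̲̲̲^hol_TF`. [cite: MochizukiAbsTopIII2015, Definition 4.1 (ii) p.102] -/
theorem isIso_of_isIso_base {P Q : HolTFPair 𝔄} (φ : P ⟶ Q) [IsIso φ.base] : IsIso φ :=
  ⟨⟨Hom.ofBase Q P (inv φ.base),
    Hom.ext_of_base (by change φ.base ≫ inv φ.base = 𝟙 P.X; simp),
    Hom.ext_of_base (by change inv φ.base ≫ φ.base = 𝟙 Q.X; simp)⟩⟩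

/-- Conversely the structure part of an isomorphism of pairs is an isomorphism.
[cite: MochizukiAbsTopIII2015, Definition 4.1 (ii) p.102] -/
theorem isIso_base_of_isIso {P Q : HolTFPair 𝔄} (φ : P ⟶ Q) [IsIso φ] : IsIso φ.base :=
  ⟨⟨(inv φ).base, by rw [← comp_base, IsIso.hom_inv_id, id_base],
    by rw [← comp_base, IsIso.inv_hom_id, id_base]⟩⟩

/-- **Rmk 4.2.1 at the model, `T = TF`**: "the id-rigidity portion of Proposition 4.2, (i), is false for
the '`𝒞̲̲`' and '`𝒞̲̲̲`' versions of `𝒞^hol_T`" — the groupoid `Core 𝒞^hol_TF` (structure-isomorphisms =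
isomorphisms, `isIso_of_isIso_base`) is not id-rigid as soon as some `𝕏 ∈ Ob(EA)` has a nontrivial central
automorphism. [cite: MochizukiAbsTopIII2015, Remark 4.2.1 p.106] -/
theorem not_isIdRigid_core (X : 𝔄.EA) (z : X ≅ X) (hz : z ≠ Iso.refl X)
    (hc : ∀ g : X ≅ X, g ≪≫ z = z ≪≫ g) : ¬ IsIdRigid (Core (HolTFPair 𝔄)) := by
  refine not_isIdRigid_core_of_central ((ofEA 𝔄).obj X) ((ofEA 𝔄).mapIso z) ?_ ?_
  · intro h
    apply hz
    apply Iso.ext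
    exact congrArg (fun e => ((toEA 𝔄).mapIso e).hom) h
  · intro g
    apply Iso.ext
    apply Hom.ext_of_base
    have := congrArg Iso.hom (hc ((toEA 𝔄).mapIso g))
    simpa using this

/-- `(𝕏 ↶ k) ↦ 𝕏` is an equivalence `𝒞^hol_TF ⥲ EA` (quasi-inverse `𝕏 ↦ (𝕏 ↶ 𝒜_𝕏)`, abc-iut-L4-t10's
`ofEA_isEquivalence`). [cite: MochizukiAbsTopIII2015, Proposition 4.2 (i) p.105] -/
theorem toEA_isEquivalence (𝔄 : AutHolFieldFunctor.{u}) : (toEA 𝔄).IsEquivalence :=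
  Functor.IsEquivalence.mk' (ofEA 𝔄) (etaEA 𝔄).symm (eqToIso (ofEA_comp_toEA (𝔄 := 𝔄)))

/-- **Prop 4.2 (i), `sB` clause, at the model (`T = TF`)**: for every isomorphism-closed property `Q` of
objects of `EA` (print: "of strictly Belyi type", Def 4.1 (ii)/(iii); the interface carries no such
predicate, so `Q` is a parameter), if the full subcategory `EA_Q` is id-rigid then so is the full
subcategory `𝒞^{hol-Q}_TF` of pairs whose structure-orbispace satisfies `Q` — "the categories …
`𝒞^{hol-sB}_T = 𝒞̲^{hol-sB}_T` are id-rigid". [cite: MochizukiAbsTopIII2015, Proposition 4.2 (i) p.105] -/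
theorem isIdRigid_fullSubcategory (Q : ObjectProperty 𝔄.EA) [Q.IsClosedUnderIsomorphisms]
    (hQ : IsIdRigid Q.FullSubcategory) :
    IsIdRigid (Q.inverseImage (toEA 𝔄)).FullSubcategory :=
  haveI := toEA_isEquivalence 𝔄
  isIdRigid_of_equivalence
    ((toEA 𝔄).asEquivalence.congrFullSubcategory (P := Q.inverseImage (toEA 𝔄)) (Q := Q) rfl) hQ

end HolTFPair

namespace HolMonoidPair

variable {𝔄 : AutHolFieldFunctor.{u}} {T : ArchPairType}

/-- A morphism of `T`-pairs (`T ∈ {TM, TLG, TCG}`) whose structure part is an isomorphism is an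
isomorphism: at the model `𝒞̲̲^hol_T = 𝒞̲̲̲^hol_T`. [cite: MochizukiAbsTopIII2015, Definition 4.1 (ii) p.102] -/
theorem isIso_of_isIso_base {P Q : HolMonoidPair 𝔄 T} (φ : P ⟶ Q) [IsIso φ.base] : IsIso φ :=
  ⟨⟨Hom.ofBase Q P (inv φ.base),
    Hom.ext_of_base (by change φ.base ≫ inv φ.base = 𝟙 P.X; simp),
    Hom.ext_of_base (by change inv φ.base ≫ φ.base = 𝟙 Q.X; simp)⟩⟩

/-- Conversely the structure part of an isomorphism of `T`-pairs is an isomorphism.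
[cite: MochizukiAbsTopIII2015, Definition 4.1 (ii) p.102] -/
theorem isIso_base_of_isIso {P Q : HolMonoidPair 𝔄 T} (φ : P ⟶ Q) [IsIso φ] : IsIso φ.base :=
  ⟨⟨(inv φ).base, by rw [← comp_base, IsIso.hom_inv_id, id_base],
    by rw [← comp_base, IsIso.inv_hom_id, id_base]⟩⟩

/-- **Rmk 4.2.1 at the model, `T ∈ {TM, TLG, TCG}`**: the groupoid `Core 𝒞^hol_T` is not id-rigid as soon
as some `𝕏 ∈ Ob(EA)` has a nontrivial central automorphism.
[cite: MochizukiAbsTopIII2015, Remark 4.2.1 p.106] -/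
theorem not_isIdRigid_core (hT : T.IsMonoidType) (X : 𝔄.EA) (z : X ≅ X) (hz : z ≠ Iso.refl X)
    (hc : ∀ g : X ≅ X, g ≪≫ z = z ≪≫ g) : ¬ IsIdRigid (Core (HolMonoidPair 𝔄 T)) := by
  refine not_isIdRigid_core_of_central ((ofEA 𝔄 hT).obj X) ((ofEA 𝔄 hT).mapIso z) ?_ ?_
  · intro h
    apply hz
    apply Iso.ext
    exact congrArg (fun e => ((toEA 𝔄 T).mapIso e).hom) h
  · intro g
    apply Iso.ext
    apply Hom.ext_of_base
    have := congrArg Iso.hom (hc ((toEA 𝔄 T).mapIso g))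
    simpa using this

/-- **Prop 4.2 (i), `sB` clause, at the model (`T ∈ {TM, TLG, TCG}`)**: for every isomorphism-closed
property `Q` of objects of `EA`, if `EA_Q` is id-rigid then so is the full subcategory of `𝒞^hol_T` of
pairs whose structure-orbispace satisfies `Q`. [cite: MochizukiAbsTopIII2015, Proposition 4.2 (i) p.105] -/
theorem isIdRigid_fullSubcategory (hT : T.IsMonoidType) (Q : ObjectProperty 𝔄.EA)
    [Q.IsClosedUnderIsomorphisms] (hQ : IsIdRigid Q.FullSubcategory) :
    IsIdRigid (Q.inverseImage (toEA 𝔄 T)).FullSubcategory :=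
  haveI := toEA_isEquivalence (𝔄 := 𝔄) hT
  isIdRigid_of_equivalence
    ((toEA 𝔄 T).asEquivalence.congrFullSubcategory (P := Q.inverseImage (toEA 𝔄 T)) (Q := Q) rfl) hQ

end HolMonoidPair

end Literature.AnabelianGeometry.AbsoluteAnabelian
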